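import Mathlib.Algebra.BigOperators.Associated
import Mathlib.Data.Nat.PrimeFin
import Mathlib.RingTheory.Int.Basic

/-!
# Route LinearSystemTorelli — crux `LocalTubeSpan` (stmt-HodgeConjecture-2490): coprime shift, subtractive form

Helper file (`--supports stmt-HodgeConjecture-2490`, line `Sketch` of the crux chain, cycle 10,
"asymmetric engine", stub `stub_coprimeShiftSub`).

Move (1) of the cycle-10 asymmetric engine needs an integer `j` making `α - j κ` coprime to
`β ≠ 0`, knowing only that `κ`, `α`, `β` generate the unit ideal of `ℤ`.

* `localTubeSpan_coprimeShiftSub` — if `c₁ * κ + c₂ * α + c₃ * β = 1` and `β ≠ 0`, then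
  `IsCoprime (α - j * κ) β` for some `j : ℤ`.

Proof (the prime-avoidance argument of the companion file
`LinearSystemTorelliLocalTubeSpanCoprimeShift`, here without any parity hypothesis): no prime
divides `κ`, `α` and `β` (it would divide `c₁ κ + c₂ α + c₃ β = 1`).  Take `j = ∏ p` over the
prime factors `p` of `β ≠ 0` NOT dividing `α`.  A common prime `p` of `α - j κ` and `β` either
divides `α` — then `p ∤ j` (the factors of `j` are primes not dividing `α`), so `p ∣ j κ` gives
`p ∣ κ`, excluded — or does not — then `p ∣ β` puts `p` among the factors of `j`, so
`p ∣ (α - j κ) + j κ = α`, a contradiction.  Mathlib only; no named facts; no `sorry`.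
-/

-- `Summit.HodgeConjecture.HodgeConjecture.Theorems` is the mandated namespace (single-conjunct summit:
-- Sub = Summit), which `linter.dupNamespace` flags on every declaration; the lakefile turns the
-- linter off tree-wide (weak option), restated here so stand-alone elaboration is warning-free too.
set_option linter.dupNamespace false

namespace Summit.HodgeConjecture.HodgeConjecture.Theorems

/-- **Coprime shift, subtractive form** (stub `stub_coprimeShiftSub` of the line `Sketch`, pure
arithmetic).  If `c₁ * κ + c₂ * α + c₃ * β = 1` and `β ≠ 0`, then `α - j * κ` is coprime to `β`
for some integer `j`, namely `j = ∏ p` over the prime factors `p` of `β` not dividing `α`: no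
prime divides `κ`, `α` and `β` (it would divide `1`), and a common prime of `α - j κ` and `β`
dividing `α` (resp. not dividing `α`) does not (resp. does) divide `j`, whence it divides `κ`
(resp. `α`) — impossible either way. [folklore] -/
theorem localTubeSpan_coprimeShiftSub (α β κ c₁ c₂ c₃ : ℤ) (hrel : c₁ * κ + c₂ * α + c₃ * β = 1)
    (hβ : β ≠ 0) : ∃ j : ℤ, IsCoprime (α - j * κ) β := by
  classical
  -- adapted from the tree's `localTubeSpan_coprimeShift`
  -- (file `LinearSystemTorelliLocalTubeSpanCoprimeShift.lean`), itself adapted from the Literature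
  -- lemma `exists_isCoprime_add_mul` (file `HeckeOperatorsDoubleCoset.lean`).
  -- Step 1 (primitivity): no prime divides `κ`, `α` and `β`.
  have hprim : ∀ p : ℕ, p.Prime → (p : ℤ) ∣ κ → (p : ℤ) ∣ α → ¬ (p : ℤ) ∣ β := by
    intro p hp hpκ hpα hpβ
    have hpZ : Prime (p : ℤ) := Nat.prime_iff_prime_int.mp hp
    refine hpZ.not_dvd_one ?_
    rw [← hrel]
    exact dvd_add (dvd_add (hpκ.mul_left _) (hpα.mul_left _)) (hpβ.mul_left _)
  -- Step 2: the shift `j = ∏ p` over the prime factors `p` of `β ≠ 0` not dividing `α`.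
  set T : Finset ℕ := β.natAbs.primeFactors.filter (fun p : ℕ ↦ ¬ (p : ℤ) ∣ α)
  set s : ℤ := ∏ p ∈ T, (p : ℤ) with hs
  refine ⟨s, Int.isCoprime_iff_nat_coprime.mpr (Nat.coprime_of_dvd fun p hp hpa hpb ↦ ?_)⟩
  rw [← Int.natCast_dvd] at hpa hpb
  have hpZ : Prime (p : ℤ) := Nat.prime_iff_prime_int.mp hp
  by_cases hpα : (p : ℤ) ∣ α
  · -- `p ∉ T`, hence `p ∤ s`, hence `p ∣ κ`: excluded by Step 1
    have hps : ¬ (p : ℤ) ∣ s := by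
      intro h
      rw [hs, hpZ.dvd_finsetProd_iff] at h
      obtain ⟨q, hqT, hpq⟩ := h
      rw [Int.natCast_dvd_natCast] at hpq
      obtain ⟨hq, hqα⟩ := Finset.mem_filter.mp hqT
      obtain rfl : p = q :=
        (Nat.prime_dvd_prime_iff_eq hp (Nat.prime_of_mem_primeFactors hq)).mp hpq
      exact hqα hpα
    have hsκ : (p : ℤ) ∣ s * κ := by
      have := dvd_sub hpα hpa
      rwa [sub_sub_cancel] at this
    exact hprim p hp ((hpZ.dvd_or_dvd hsκ).resolve_left hps) hpα hpb
  · -- `p ∣ β` and `p ∤ α`: `p ∈ T`, hence `p ∣ s`, hence `p ∣ α` after all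
    have hpT : p ∈ T :=
      Finset.mem_filter.mpr
        ⟨Nat.mem_primeFactors.mpr ⟨hp, Int.natCast_dvd.mp hpb, Int.natAbs_ne_zero.mpr hβ⟩, hpα⟩
    have hps : (p : ℤ) ∣ s := Finset.dvd_prod_of_mem _ hpT
    refine hpα ?_
    have := dvd_add hpa (dvd_mul_of_dvd_left hps κ)
    rwa [sub_add_cancel] at this

end Summit.HodgeConjecture.HodgeConjecture.Theorems
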